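import Literature.NumberTheory.DiophantineGeometry.AbcWave0
import Literature.NumberTheory.DiophantineGeometry.StrongHall
import Literature.NumberTheory.EllipticCurves.Szpiro
import Literature.Barriers.ABC.EpsilonCannotBeDropped
import HarnessLib
import HarnessLib.Audit
import HarnessLib.Audit.TribunalTags

/-!
# Strong-Hypothesis Library — summit `ABC` (D-0034, skeleton)

The REGISTRY of known strong hypotheses `H` (open conjectures with `H ⇒ P` landed or printed) and of
known EQUIVALENT REFORMULATIONS `E` (`E ↔ P` landed or printed) for the single-problem summit `ABC`.
Every entry carries `@[strong_hypothesis "ABC.ABC"]`; the kernel tribunal (`#h21_tribunal`, D-0033 T1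
rule (a)) probes each registered `H` against a route crux `C` for `H → C`. The bridges `H → P` / `H ↔ P`
live summit-side in `Summits/ABC/StrongHypotheses.lean`. Nothing already in the tree is restated:
existing conjecture `def`s are tagged in place with `attribute [strong_hypothesis …]`; the two NEW
hypotheses stated below are closures of famous families that exist in the tree only as parametrised
predicates (`NConjecture n`, the `K`-fixed abc inequality), each an OPEN statement (`@[conjecture]`,
docstring `OPEN CONJECTURE — … [status: open]`).

## The summit's problem

* `ABC.ABC` — decl `_root_.ABC : Prop := Literature.Abc.ABCConjecture`
  (`Summits/ABC/ABC/Statement.lean`, unfolded by `ABC_iff`): the abc conjecture of Masser–Oesterlé in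
  the strong `C(ε)` form of Bombieri–Gubler, Conj. 12.2.2 — for every real `ε > 0` there is `C > 0`
  such that every abc triple (coprime positive naturals `a + b = c`, `IsABCTriple a b c`) satisfies
  `c < C · rad(abc)^{1+ε}` (`rad` computed in `ℕ`, `^` = `Real.rpow`). The `≤`/unsigned-`C` sentence
  printed by Bombieri–Gubler ("abcLe" below) is equivalent (`abcLt_of_abcLe`, `DegreeConjectureAbc.lean`).

## Census of strong hypotheses `H` and equivalent criteria `E`

| # | name | one-line statement | relation to `ABC` | source | status here | bridge |
|---|---|---|---|---|---|---|
| 1 | quality (finiteness) form of abc | `∀ ε > 0`, only finitely many abc triples have quality `log c / log rad(abc) > 1 + ε` | equivalent | Masser 1985 / Oesterlé 1988; Waldschmidt 2014 Conj. 2 ("easily seen … equivalent") | registered: `Literature.NumberTheory.DiophantineGeometry.ABCQualityForm` | landed: `Summit.ABC.StrongHypotheses.abcQualityForm_iff_abc` (over `abcQualityForm_iff_forall_exists_const`) |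
| 2 | modified Szpiro conjecture | `max(|c₄|³, |c₆|²) ≤ C(ε) N_E^{6+ε}` for global minimal models of all `E/ℚ` | equivalent | Oesterlé 1988, §3 Conj. 4, pp. 169–170 ("la conjecture 3 équivaut …") | registered: `Literature.NumberTheory.EllipticCurves.ModifiedSzpiroConjecture` | landed: `….modifiedSzpiro_iff_abc` (over `abcLe_iff_modifiedSzpiro_holds`) |
| 3 | generalized Szpiro conjecture (B–G form) | `max(|Δ|, |c₄|³) ≪_ε cond(E)^{6+ε}` for minimal models of all `E/ℚ` | equivalent | Bombieri–Gubler 2006, Conj. 12.5.11 and Thm. 12.5.12 (a)⟺(c) | registered: `Literature.NumberTheory.EllipticCurves.GeneralizedSzpiroConjectureBG` | landed: `….generalizedSzpiroBG_iff_abc` (over `strongHall_iff_generalizedSzpiroBG`, `abcLe_iff_strongHall`) |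
| 4 | strong Hall conjecture | primitive `x³ − y² = z ≠ 0` has `|x| ≪_ε rad(z)^{2+ε}`, `|y| ≪_ε rad(z)^{3+ε}` | equivalent | Bombieri–Gubler 2006, Conj. 12.5.3 and Thm. 12.5.12 (a)⟺(b) | registered: `Literature.NumberTheory.DiophantineGeometry.StrongHallConjecture` | landed: `….strongHall_iff_abc` (over `abcLe_iff_strongHall`) |
| 5 | Baker's explicit abc conjecture | `c < (6/5) N (log N)^ω / ω!`, `N = rad(abc)`, `ω = ω(abc)`, abc triples with `a < b` | strictly stronger | Baker 2004, Conj. 4; "gives an explicit `C(ε)`" ibid. §3; Laishram–Shorey 2012 Thm. 1 | registered: `Literature.NumberTheory.DiophantineGeometry.BakerExplicitABC` | landed: `….bakerExplicitABC_imp_abc` (over `BakerExplicitABC.forall_exists_const`) |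
| 6 | uniform abc conjecture for number fields | `H_K(a:b:c) < C^{[K:ℚ]} (|D_K| N_K(a,b,c))^{1+ε}`, all number fields `K`, one `C = C(ε)` | strictly stronger | Granville–Stark 2000, §1 eq. (1) (`K = ℚ` is Masser–Oesterlé, ibid. opening sentence; Evertse–Győry 2015 §4.6) | registered: `Literature.NumberTheory.DiophantineGeometry.UniformABCConjecture` | landed: `….uniformABC_imp_abc` (over `UniformABCConjecture.abc_rat`) |
| 7 | Robert–Stewart–Tenenbaum Conjecture A, upper half (1·5) | `c < k exp(4√(3 log k/log₂ k)(1 + log₃ k/(2 log₂ k) + C₁/log₂ k))`, `k = rad(abc)` | strictly stronger | Robert–Stewart–Tenenbaum 2014, Conj. A (1.5), remark "`A₂ = 4√3 + ε`" | registered: `Literature.Barriers.ABC.RSTConjectureAUpper` | landed: `….rstConjectureAUpper_imp_abc` (over `RSTConjectureAUpper.imp_abc`) |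
| 8 | Browkin–Brzeziński `n`-conjecture, all `n ≥ 3` | `max |aᵢ| ≤ C(n,ε) rad(a₁⋯aₙ)^{2n−5+ε}` for coprime `a₁+⋯+aₙ = 0` without vanishing subsums | strictly stronger (case `n = 3` is abc in `ℤ`-form) | Browkin–Brzeziński 1994, §1 | NEW: `Literature.StrongHypotheses.ABC.NConjectureAll` (closure of the parametrised `NConjecture n`) | printed: `Summit.ABC.StrongHypotheses.NConjectureAllImpliesABC` |
| 9 | abc conjecture over every number field (`K` fixed, `C = C(K, ε)`) | `H_K(a:b:c) < C · N_K(a,b,c)^{1+ε}` for nonzero `a + b = c` in `K` | strictly stronger (case `K = ℚ` is abc) | Vojta 1987 p. 84 / Elkies 1991, as reported by Granville–Stark 2000 §1; Bombieri–Gubler 2006 Conj. 14.4.12 | NEW: `Literature.StrongHypotheses.ABC.NumberFieldABCConjecture` | printed: `Summit.ABC.StrongHypotheses.NumberFieldABCConjectureImpliesABC` |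
| 10 | Vojta's general (height) conjecture 5.2.6 | `h_{K_V}(P) ≤ (1+ε) (N_S(D,P) + d(P)) + ε h_A(P) + O(1)` off a proper Zariski-closed set | strictly stronger (⟹ uniform abc in bounded degree, Granville–Stark 2000 §1; ⟹ abc, Vojta 1987 §5.ABC) | Vojta 1987, Conj. 5.2.6 | not typeable (missing notion: Weil height machine attached to divisors on projective varieties over number fields, truncated counting function `N_S(D,P)`, logarithmic discriminant `d(P)`; the inventory's `abc.S23` was skipped for the same reason) | none |
| 11 | Frey's degree conjecture on the Frey curves | `deg φ_E ≪_ε N^{2+ε}` for the modular parametrisation of `freyCurve a b` | equivalent (Murty 1999 Thm. 1, with Pasten 2024 Rem. 3.3) | Murty 1999, Thm. 1 | not registered: it exists only INLINE as the right-hand side of the named fact `Literature.NumberTheory.EllipticCurves.abcLe_iff_freyDegreeConjecture` (no closed decl to tag; the route decl `Summit.ABC.ABC.Theses.DefiniteXi.FreyDegreeBound` is a Theses decl, never tagged) | none (the equivalence itself is an undischarged named fact) |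

## Deliberately NOT registered (and why)

* WEAKER than the summit (consequences of `ABC`, so `H → C` would say nothing about summit strength):
  `Literature.NumberTheory.EllipticCurves.SzpiroConjecture` and `SzpiroConjectureOver K` (abc ⟹ Szpiro,
  `szpiro_of_abcLe_holds`; conversely Szpiro gives abc only with exponent `6/5`, `abc_sixFifths_of_szpiro`);
  `HallConjecture` (weak Hall, exponent `2`/`1/2 − ε`), `ErdosWoodsConjecture`, `FermatCatalanConjecture`,
  `Literature.NumberTheory.EllipticCurves.LangHeightLowerBoundConjecture` (⟸ Szpiro, Hindry–Silverman),
  `Literature.NumberTheory.DiophantineGeometry.XYZConjecture` (its open half follows from weak abc + GRH),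
  `Literature.Barriers.ABC.SmallDerivativesConjecture` (Pasten 2021 Conj. 3.9: EQUIVALENT to OESTERLÉ's
  exponent-`M` abc conjecture `∃ M, c < rad(abc)^M`, which is strictly weaker than the summit's `1 + ε`;
  `smallDerivatives_of_abcQualityForm`, `exists_exponent_of_smallDerivatives`).
* INCOMPARABLE as typed: `Literature.NumberTheory.DiophantineGeometry.WeakABCConjecture` (`c < rad(abc)²`,
  no `ε`, no constant: neither implies nor is implied by `ABC`); `Literature.Barriers.ABC.IUTDisputedClaim`
  (Theorem B of the disputed explicit-IUT paper as printed: `|abc| ≤ 2⁴ max(exp(1.7·10³⁰ ε^{-166/81}),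
  rad(abc)^{3(1+ε)})` for `ε ≤ 1` — as a `Prop` it yields only `c ≪_ε rad(abc)^{(3/2)(1+ε)}`
  (`IUTDisputedClaim.abc_le_rad_rpow`), NOT the exponent `1 + ε`; besides, its status is a contested
  claim, D-0012).
* NEGATION FLAG: `Literature.NumberTheory.DiophantineGeometry.ABCNegation` (`↔ ¬ ABC`; the abc-neg flag).
* THEOREMS, not hypotheses: Mason–Stothers (`mason_stothers` = Mathlib `Polynomial.abc`, the abc theorem
  for polynomials), Stewart–Yu (`stewart_yu`), Baker–Wüstholz.
* ROUTE CRITERIA and summit-side conjecture defs: every closed `…Conjecture : Prop` found under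
  `Summits/ABC/ABC/` lives in a `Theses` file (`SemistableDegreeConjecture`, `FreyDegreeBound`, …) or in an
  unbuilt `Cruxes/…/Sketch*.lean` (`StratifiedDegreeConjecture`, `ManinSupNormConjecture`) — Theses decls
  are what the tribunal probes (tagging them is circular) and sketches are not built; none is tagged.
* Robert–Stewart–Tenenbaum's LOWER half `RSTConjectureALower` (1·6) points towards abc-neg-type growth
  (`ε` cannot be dropped), not towards `ABC`.

## Sources (all keys in `lean/references.bib`)

[Oesterle1988] §1, §3 Conj. 4; [BombieriGubler2006] Conj. 12.2.2, 12.5.3, 12.5.11, Thm. 12.5.12,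
Conj. 14.4.12; [Waldschmidt2014] Conj. 2, Conj. 15; [Baker2004] Conj. 4, §3; [LaishramShorey2012] Thm. 1;
[GranvilleStark2000] §1 eq. (1); [EvertseGyory2015] §4.6; [RobertStewartTenenbaum2014] Conj. A;
[BrowkinBrzezinski1994] §1; [Vojta1987] Conj. 5.2.6, §5 App. ABC; [Elkies1991ABCMordell];
[MurtyCongruencePrimes1999] Thm. 1; [Pasten2021] Conj. 3.9, Cor. 4.6; [SilvermanAEC2009] VIII.11.
-/

noncomputable section

open UniqueFactorizationMonoid

/-! ## Existing conjecture `def`s, tagged in place (no restatement) -/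

attribute [strong_hypothesis "ABC.ABC"]
  Literature.NumberTheory.DiophantineGeometry.ABCQualityForm
  Literature.NumberTheory.EllipticCurves.ModifiedSzpiroConjecture
  Literature.NumberTheory.EllipticCurves.GeneralizedSzpiroConjectureBG
  Literature.NumberTheory.DiophantineGeometry.StrongHallConjecture
  Literature.NumberTheory.DiophantineGeometry.BakerExplicitABC
  Literature.NumberTheory.DiophantineGeometry.UniformABCConjecture
  Literature.Barriers.ABC.RSTConjectureAUpper

namespace Literature.StrongHypotheses.ABC

open Literature.NumberTheory.DiophantineGeometry

/-! ## Newly stated closures of parametrised families -/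

/-- OPEN CONJECTURE — the **`n`-conjecture of Browkin–Brzeziński for every `n ≥ 3`**: for each `n ≥ 3`
and `ε > 0` there is `C = C(n, ε)` such that all integers `a₁ + ⋯ + aₙ = 0` with no common prime factor
and no vanishing proper subsum satisfy `max |aᵢ| ≤ C · rad(a₁ ⋯ aₙ)^{2n − 5 + ε}` (Browkin–Brzeziński,
*Some remarks on the abc-conjecture*, Math. Comp. 62 (1994), §1, where it is posed as the "`n`-conjecture"
generalising the abc conjecture, the case `n = 3` — exponent `2·3 − 5 = 1` — being the abc conjecture in
its `a + b + c = 0` integer form; their Thm. 1 shows `2n − 5` cannot be lowered). The closure over `n` of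
the tree's parametrised predicate `NConjecture n` (`AbcWave0.lean`, abc.S20); STRICTLY STRONGER than the
summit `ABC` (it contains the case `n = 3`; the cases `n ≥ 4` are open and not known to follow from abc).
Bridge PRINTED (summit file). [cite: BrowkinBrzezinski1994, §1 (the n-conjecture; n = 3 is abc)] [status: open] -/
@[conjecture, strong_hypothesis "ABC.ABC"]
def NConjectureAll : Prop :=
  ∀ n : ℕ, 3 ≤ n → NConjecture n

/-- OPEN CONJECTURE — the **abc conjecture over every number field** (`K` fixed, constant depending on
`K` and `ε`): for every number field `K` and every `ε > 0` there is `C = C(K, ε)` such that all nonzero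
`a + b = c` in `K` satisfy `H_K(a : b : c) < C · N_K(a, b, c)^{1+ε}`, with `H_K = Height.mulHeight ![a,b,c]`
the relative multiplicative height and `N_K = radicalNorm a b c` Granville–Stark's conductor (product of
the norms of the primes at which `a, b, c` do not all have the same valuation). This is the `K`-by-`K`
form of "Vojta [LNM 1239, p. 84] showed how to formulate the abc-conjecture in arbitrary number fields
(from which Elkies elegantly deduced Faltings's Theorem)" as reported by Granville–Stark, §1, i.e. their
uniform inequality (1) (`UniformABCConjecture`) with the factor `C^{[K:ℚ]} |D_K|^{1+ε}` absorbed into a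
`K`-dependent constant; Bombieri–Gubler print the bounded-degree logarithmic form as "the strong
abc-conjecture of Elkies over number fields", Conj. 14.4.12 (nearest printed statement; the rendering
here is its `[K:ℚ]`-th power at fixed `K`, stated with the tree's `radicalNorm`). STRICTLY STRONGER than
`ABC` (case `K = ℚ`: `H_ℚ(a:b:c) = c`, `N_ℚ ≤ rad(abc)` for an abc triple — cf.
`UniformABCConjecture.abc_rat`) and implied by `UniformABCConjecture`. Bridge PRINTED (summit file).
[cite: BombieriGubler2006, Conj. 14.4.12 (with GranvilleStark2000 §1 eq. (1))] [status: open] -/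
@[conjecture, strong_hypothesis "ABC.ABC"]
def NumberFieldABCConjecture : Prop :=
  ∀ (K : Type) [Field K] [NumberField K], ∀ ε : ℝ, 0 < ε → ∃ C : ℝ, ∀ a b c : K,
    a ≠ 0 → b ≠ 0 → c ≠ 0 → a + b = c →
      Height.mulHeight ![a, b, c] < C * (radicalNorm a b c : ℝ) ^ (1 + ε)

end Literature.StrongHypotheses.ABC
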